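import Summits.CriticalPhenomena.SAWScalingLimit.Theses.SAWRenewalTightness
import Literature.Probability.LatticeModels.MedialExplorationChains

/-!
# `SurgeryReduction` (stmt-CriticalPhenomena-4731): separate shell traversals of a lattice polyline give disjoint lattice dives

Support file (helper lemmas, `--supports stmt-CriticalPhenomena-4731`) for the glue item
`Summit.CriticalPhenomena.SAWScalingLimit.Theses.SAWRenewalTightness.SurgeryReduction`
(`AnnularMassDecay → TubeLowerBound → ShellCrossingBound`).  The first step of ANY surgery / annular-mass
argument towards `ShellCrossingBound` is deterministic: the event of `ShellCrossingBound` is phrased through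
`Curve.HasTraversals` of the POLYLINE of the walk (a continuum notion, dyadic time), while `AnnularMassDecay`
counts LATTICE sub-walks ("annular in-bridges": interior vertices in the open annulus, endpoint in the inner
disc).  This file proves the conversion, for polylines through arbitrary point sequences with short steps:

* `pieceIdx (List.range n) t` — the index of the vertex the polyline through `p 0, …, p n` has last passed at time `t`
  (monotone in `t`, `≤ n`), with `polyline_mem_segment_vertex` (the polyline is on the segment from that vertex
  to the next) and `dist_polyline_vertex_le` (it is within one step length of that vertex);
* `exists_dives_of_hasTraversals` — if consecutive points are `δ`-close and the polyline has `2j` separate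
  traversals of `D(x; ρ, R)` with `ρ + δ < R − δ`, then there are `j` index pairs
  `a₁ < b₁ < a₂ < b₂ < ⋯ < a_j < b_j ≤ n` with `dist (p aₘ) x ≥ R − δ` and `dist (p bₘ) x ≤ ρ + δ` ("dives");
* `exists_inBridge_of_dive` — inside a dive sits an annular in-bridge for the radii `(ρ + δ, R − δ)`: a
  sub-interval `[a′, b′]` whose first point is at distance `≥ R − δ`, last point at distance `≤ ρ + δ`, and all
  interior points strictly inside the open annulus (the exact shape of the walks counted by `AnnularMassDecay`);
* the SAW side (mesh-`δ` polyline of a self-avoiding walk of `Ω_δ`, lattice units, membership of the bridges in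
  `SAW.Zd.saws`) is the companion file `SAWRenewalTightnessSurgeryReductionBridges.lean`.

Everything here is elementary and model-free. [folklore]
-/

noncomputable section

open Set Metric
open scoped unitInterval
open Literature.Probability.LatticeModels Literature.Probability.RandomPlanarGeometry

namespace Summit.CriticalPhenomena.SAWScalingLimit.Theorems.SurgeryReduction

/-! ### Which vertex a polyline has last passed -/

section Polyline

section General

variable {E : Type*}

/-- `[p 0, …, p n] = p 0 :: [p 1, …, p n]`. [folklore] -/
theorem map_range_succ_eq_cons (p : ℕ → E) (n : ℕ) :
    (List.range (n + 1)).map p = p 0 :: (List.range n).map (fun i => p (i + 1)) := by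
  rw [List.range_succ_eq_map, List.map_cons, List.map_map]
  rfl

/-- The index `pieceIdx (List.range n) t` of the vertex last passed at time `t` by a polyline through
`n + 1` points (dyadic parametrisation of `polyline`; `pieceIdx` of `MedialExplorationChains.lean` depends on the
list only through its length) is at most `n`. [folklore] -/
theorem pieceIdx_range_le (n : ℕ) (t : I) : pieceIdx (List.range n) t ≤ n := by
  simpa using pieceIdx_le (List.range n) t

/-- The vertex index is monotone in time. [folklore] -/
theorem pieceIdx_range_mono (n : ℕ) {s t : I} (hst : s ≤ t) :
    pieceIdx (List.range n) s ≤ pieceIdx (List.range n) t :=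
  pieceIdx_mono (List.range n) hst

end General

variable {E : Type*} [NormedAddCommGroup E] [NormedSpace ℝ E]

/-- At every time the polyline through `p 0, …, p n` lies on the segment from the vertex it has last passed
to the next one (the degenerate segment at `p n` on the final constant stretch). [folklore] -/
theorem polyline_mem_segment_vertex (p : ℕ → E) (n : ℕ) (t : I) :
    polyline ((List.range (n + 1)).map p) t ∈ segment ℝ (p (pieceIdx (List.range n) t)) (p (min (pieceIdx (List.range n) t + 1) n)) := by
  rw [map_range_succ_eq_cons]
  set l : List E := (List.range n).map (fun i => p (i + 1)) with hl
  have hlen : l.length = n := by simp [hl]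
  have hidx : pieceIdx l t = pieceIdx (List.range n) t := by rw [hl, pieceIdx_map]
  have hmem : polyline (p 0 :: l) t ∈ segment ℝ (pieceAt (p 0) l t).1 (pieceAt (p 0) l t).2 :=
    polylineFrom_mem_segment_pieceAt (p 0) l t
  have hget : ∀ (k : ℕ) (hk : k < (p 0 :: l).length), (p 0 :: l)[k] = p k := by
    intro k hk
    cases k with
    | zero => rfl
    | succ k =>
      simp [hl]
  rcases pieceAt_eq_getElem_or (p 0) l t with ⟨h, heq⟩ | ⟨h, heq⟩
  · -- a genuine consecutive pair `(p k, p (k+1))`, `k < n`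
    have hk : pieceIdx l t < n := by
      have : ((p 0 :: l).zip l).length = n := by simp [hl]
      omega
    have hpair : ((p 0 :: l).zip l)[pieceIdx l t]'h = (p (pieceIdx l t), p (pieceIdx l t + 1)) := by
      rw [List.getElem_zip, hget]
      refine Prod.ext rfl ?_
      simp [hl]
    rw [heq, hpair] at hmem
    rw [← hidx, min_eq_left (by omega : pieceIdx l t + 1 ≤ n)]
    exact hmem
  · -- the final constant stretch at `p n`
    rw [heq] at hmem
    have hlast : (p 0 :: l).getLast (by simp) = p n := by
      rw [List.getLast_eq_getElem, hget]
      simp [hl]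
    have hv : pieceIdx (List.range n) t = n := by rw [← hidx, h, hlen]
    rw [hv, min_eq_right (Nat.le_succ n)]
    simpa [hlast] using hmem

/-- If consecutive points are `δ`-close, the polyline is always within `δ` of the vertex it has last
passed. [folklore] -/
theorem dist_polyline_vertex_le {p : ℕ → E} {n : ℕ} {δ : ℝ} (hδ : 0 ≤ δ)
    (hp : ∀ i < n, dist (p i) (p (i + 1)) ≤ δ) (t : I) :
    dist (polyline ((List.range (n + 1)).map p) t) (p (pieceIdx (List.range n) t)) ≤ δ := by
  have hmem := polyline_mem_segment_vertex p n t
  have hsum := dist_add_dist_of_mem_segment hmem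
  set k := pieceIdx (List.range n) t with hk
  have hkn : k ≤ n := pieceIdx_range_le n t
  have hseg : dist (p k) (p (min (k + 1) n)) ≤ δ := by
    rcases lt_or_ge k n with h | h
    · rw [min_eq_left (by omega)]; exact hp k h
    · rw [min_eq_right (by omega), le_antisymm hkn h, dist_self]; exact hδ
  rw [dist_comm]
  linarith [dist_nonneg (x := polyline ((List.range (n + 1)).map p) t) (y := p (min (k + 1) n))]

/-! ### Separate traversals give disjoint dives -/

/-- **`2j` separate traversals of `D(x; ρ, R)` by a polyline with `δ`-short steps give `j` disjoint dives of
its vertex sequence**: index pairs `a₁ < b₁ < a₂ < ⋯ < a_j < b_j ≤ n` with `p aₘ` at distance `≥ R − δ` from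
`x` and `p bₘ` at distance `≤ ρ + δ` (each pair of consecutive traversals contains, in order, a time outside
`B(x, R)` and a later time in `B̄(x, ρ)`; pass to the vertices last visited at these times). [folklore] -/
theorem exists_dives_of_hasTraversals {p : ℕ → E} {n : ℕ} {δ : ℝ} (hδ : 0 ≤ δ)
    (hp : ∀ i < n, dist (p i) (p (i + 1)) ≤ δ) {x : E} {ρ R : ℝ} (hρR : ρ + δ < R - δ) {j : ℕ}
    (h : (⟨polyline ((List.range (n + 1)).map p)⟩ : Curve E).HasTraversals (2 * j) x ρ R) :
    ∃ a b : Fin j → ℕ, (∀ m, a m < b m) ∧ (∀ m, b m ≤ n) ∧ (∀ ⦃m m' : Fin j⦄, m < m' → b m < a m') ∧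
      (∀ m, R - δ ≤ dist (p (a m)) x) ∧ (∀ m, dist (p (b m)) x ≤ ρ + δ) := by
  obtain ⟨s, t, hst, hsep⟩ := h
  set γ : Curve E := ⟨polyline ((List.range (n + 1)).map p)⟩ with hγ
  -- the vertex last passed at a time, and transfer of the radial constraints to it
  set K : I → ℕ := fun u => pieceIdx (List.range n) u with hK
  have hKγ : ∀ u : I, dist (γ u) (p (K u)) ≤ δ := fun u => dist_polyline_vertex_le hδ hp u
  have inner_of : ∀ u : I, dist (γ u) x ≤ ρ → dist (p (K u)) x ≤ ρ + δ := fun u hu =>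
    calc dist (p (K u)) x ≤ dist (p (K u)) (γ u) + dist (γ u) x := dist_triangle _ _ _
      _ ≤ δ + ρ := add_le_add (by rw [dist_comm]; exact hKγ u) hu
      _ = ρ + δ := add_comm _ _
  have outer_of : ∀ u : I, R ≤ dist (γ u) x → R - δ ≤ dist (p (K u)) x := fun u hu => by
    linarith [dist_triangle (γ u) (p (K u)) x, hKγ u]
  -- indices of the two traversals used for the `m`-th dive
  have h2 : ∀ m : Fin j, 2 * (m : ℕ) < 2 * j := fun m => by omega
  have h2' : ∀ m : Fin j, 2 * (m : ℕ) + 1 < 2 * j := fun m => by omega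
  let i₁ : Fin j → Fin (2 * j) := fun m => ⟨2 * m, h2 m⟩
  let i₂ : Fin j → Fin (2 * j) := fun m => ⟨2 * m + 1, h2' m⟩
  -- orientation of a traversal: "in" = outside at its start
  let isIn : Fin (2 * j) → Prop := fun i => R ≤ dist (γ (s i)) x
  have hin : ∀ i, isIn i → R ≤ dist (γ (s i)) x ∧ dist (γ (t i)) x ≤ ρ := by
    intro i hi
    rcases (hst i).2 with ⟨h1, -⟩ | ⟨h1, h3⟩
    · exact absurd (hi.trans h1) (by linarith)
    · exact ⟨h1, h3⟩
  have hout : ∀ i, ¬ isIn i → dist (γ (s i)) x ≤ ρ ∧ R ≤ dist (γ (t i)) x := by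
    intro i hi
    rcases (hst i).2 with ⟨h1, h3⟩ | ⟨h1, -⟩
    · exact ⟨h1, h3⟩
    · exact absurd h1 hi
  classical
  -- the inner time of a traversal
  let tin : Fin (2 * j) → I := fun i => if isIn i then t i else s i
  have tin_inner : ∀ i, dist (γ (tin i)) x ≤ ρ := by
    intro i
    by_cases hi : isIn i
    · simp only [tin, if_pos hi]; exact (hin i hi).2
    · simp only [tin, if_neg hi]; exact (hout i hi).1
  have s_le_tin : ∀ i, s i ≤ tin i := by
    intro i
    by_cases hi : isIn i
    · simp only [tin, if_pos hi]; exact (hst i).1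
    · simp only [tin, if_neg hi]; exact le_rfl
  have tin_le_t : ∀ i, tin i ≤ t i := by
    intro i
    by_cases hi : isIn i
    · simp only [tin, if_pos hi]; exact le_rfl
    · simp only [tin, if_neg hi]; exact (hst i).1
  -- the dive: outer time `ta`, inner time `tb`, `ta ≤ tb`, inside the window of traversals `2m, 2m+1`
  let ta : Fin j → I := fun m => if isIn (i₁ m) then s (i₁ m) else t (i₁ m)
  let tb : Fin j → I := fun m => if isIn (i₁ m) then t (i₁ m) else tin (i₂ m)
  have ta_outer : ∀ m, R ≤ dist (γ (ta m)) x := by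
    intro m
    by_cases hi : isIn (i₁ m)
    · simp only [ta, if_pos hi]; exact (hin _ hi).1
    · simp only [ta, if_neg hi]; exact (hout _ hi).2
  have tb_inner : ∀ m, dist (γ (tb m)) x ≤ ρ := by
    intro m
    by_cases hi : isIn (i₁ m)
    · simp only [tb, if_pos hi]; exact (hin _ hi).2
    · simp only [tb, if_neg hi]; exact tin_inner _
  have hlt12 : ∀ m, t (i₁ m) < s (i₂ m) := fun m => hsep (show i₁ m < i₂ m from by
    change (2 * (m : ℕ)) < 2 * m + 1; omega)
  have ta_le_tb : ∀ m, ta m ≤ tb m := by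
    intro m
    by_cases hi : isIn (i₁ m)
    · simp only [ta, tb, if_pos hi]; exact (hst _).1
    · simp only [ta, tb, if_neg hi]
      exact ((hlt12 m).le.trans (s_le_tin _))
  have s_le_ta : ∀ m, s (i₁ m) ≤ ta m := by
    intro m
    by_cases hi : isIn (i₁ m)
    · simp only [ta, if_pos hi]; exact le_rfl
    · simp only [ta, if_neg hi]; exact (hst _).1
  have tb_le_t : ∀ m, tb m ≤ t (i₂ m) := by
    intro m
    by_cases hi : isIn (i₁ m)
    · simp only [tb, if_pos hi]; exact (hlt12 m).le.trans (hst _).1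
    · simp only [tb, if_neg hi]; exact tin_le_t _
  -- windows of different dives are ordered
  have hwin : ∀ ⦃m m' : Fin j⦄, m < m' → t (i₂ m) < s (i₁ m') := fun m m' hmm' =>
    hsep (show i₂ m < i₁ m' from by
      change 2 * (m : ℕ) + 1 < 2 * (m' : ℕ)
      have : (m : ℕ) < m' := hmm'
      omega)
  refine ⟨fun m => K (ta m), fun m => K (tb m), ?_, fun m => pieceIdx_range_le n _, ?_,
    fun m => outer_of _ (ta_outer m), fun m => inner_of _ (tb_inner m)⟩
  · -- `a m < b m`: `≤` by monotonicity, `≠` since outer ≠ inner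
    intro m
    have hle : K (ta m) ≤ K (tb m) := pieceIdx_range_mono n (ta_le_tb m)
    rcases hle.lt_or_eq with hlt | heq
    · exact hlt
    · exfalso
      have h1 := outer_of _ (ta_outer m)
      have h3 := inner_of _ (tb_inner m)
      rw [heq] at h1
      linarith
  · intro m m' hmm'
    have hle : K (tb m) ≤ K (ta m') :=
      pieceIdx_range_mono n ((tb_le_t m).trans ((hwin hmm').le.trans (s_le_ta m')))
    rcases hle.lt_or_eq with hlt | heq
    · exact hlt
    · exfalso
      have h1 := inner_of _ (tb_inner m)
      have h3 := outer_of _ (ta_outer m')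
      rw [heq] at h1
      linarith

/-! ### Inside a dive: an annular in-bridge -/

omit [NormedSpace ℝ E] in
/-- **A dive contains an annular in-bridge.**  If `p a` is at distance `≥ R'` from `x` and `p b`, `a ≤ b`, at
distance `≤ r' < R'`, then for the first index `b' ∈ [a, b]` at distance `≤ r'` and the last index
`a' ∈ [a, b')` at distance `≥ R'`, all points strictly between `a'` and `b'` lie in the open annulus
`r' < dist · x < R'` — the sub-sequence `p a', …, p b'` is an annular in-bridge in the sense of
`AnnularMassDecay` (radius `≥ R'` at the start, `≤ r'` at the end only). [folklore] -/
theorem exists_inBridge_of_dive {p : ℕ → E} {x : E} {r' R' : ℝ} (hrR : r' < R') {a b : ℕ} (hab : a ≤ b)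
    (ha : R' ≤ dist (p a) x) (hb : dist (p b) x ≤ r') :
    ∃ a' b', a ≤ a' ∧ a' < b' ∧ b' ≤ b ∧ R' ≤ dist (p a') x ∧ dist (p b') x ≤ r' ∧
      ∀ i, a' < i → i < b' → r' < dist (p i) x ∧ dist (p i) x < R' := by
  classical
  -- first inner index after `a`
  have hex : ∃ i, a ≤ i ∧ dist (p i) x ≤ r' := ⟨b, hab, hb⟩
  set b' := Nat.find hex with hb'
  obtain ⟨hab', hb'in⟩ : a ≤ b' ∧ dist (p b') x ≤ r' := Nat.find_spec hex
  have hb'le : b' ≤ b := Nat.find_min' hex ⟨hab, hb⟩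
  have hmin : ∀ i, a ≤ i → i < b' → r' < dist (p i) x := by
    intro i hai hib
    by_contra hcon
    exact Nat.find_min hex hib ⟨hai, not_lt.1 hcon⟩
  have hab'lt : a < b' := by
    rcases hab'.lt_or_eq with hlt | heq
    · exact hlt
    · exfalso; rw [← heq] at hb'in; linarith
  -- last outer index before `b'`
  let P : ℕ → Prop := fun i => a ≤ i ∧ R' ≤ dist (p i) x
  set a' := Nat.findGreatest P (b' - 1) with ha'
  have hPa : P a := ⟨le_rfl, ha⟩
  have hPa' : P a' := Nat.findGreatest_spec (P := P) (by omega) hPa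
  have ha'le : a' ≤ b' - 1 := Nat.findGreatest_le (P := P) (b' - 1)
  have hmax : ∀ i, a' < i → i < b' → dist (p i) x < R' := by
    intro i hia hib
    by_contra hcon
    have hPi : P i := ⟨hPa'.1.trans hia.le, not_lt.1 hcon⟩
    have := Nat.le_findGreatest (P := P) (show i ≤ b' - 1 by omega) hPi
    rw [← ha'] at this
    omega
  refine ⟨a', b', hPa'.1, by omega, hb'le, hPa'.2, hb'in, fun i hia hib => ⟨?_, hmax i hia hib⟩⟩
  exact hmin i (hPa'.1.trans hia.le) hib

end Polyline

end Summit.CriticalPhenomena.SAWScalingLimit.Theorems.SurgeryReduction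

end
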